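import Literature.Computability.Complexity.KarpChromaticGraph
import HarnessLib

/-!
# The gadget graph for `3SAT ≤ₚ 3-COLOURABILITY`: the combinatorial half of the
NP-completeness of GRAPH 3-COLOURABILITY

GRAPH 3-COLOURABILITY (Garey–Johnson [GT4] with `K = 3`; Stockmeyer 1973, Garey–Johnson–Stockmeyer
1976) is NP-complete by the textbook transformation from 3SAT (Cormen–Leiserson–Rivest–Stein,
Problem 34-3; the clause widget used here is the chain of two OR-gadgets): a PALETTE triangle
`T, F, B`; for
every variable two adjacent literal nodes `x, x̄`, both joined to `B` (so they are coloured `T/F` in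
opposite ways — the truth value); and for every clause `ℓ₀ ∨ ℓ₁ ∨ ℓ₂` two chained OR-gadgets
`p₁ q₁ o₁` (on `ℓ₀, ℓ₁`) and `p₂ q₂ o₂` (on `o₁, ℓ₂`) — triangles with `p₁ ∼ ℓ₀`, `q₁ ∼ ℓ₁`,
`p₂ ∼ o₁`, `q₂ ∼ ℓ₂` — whose final output `o₂` is joined to `F` and `B`, hence forced to `T`, which
is impossible exactly when all three literals are coloured `F`.

As in `KarpChromaticGraph.lean` (whose slot vocabulary is reused: `KarpChromatic.Slot`,
`KarpChromatic.slotLit`), the statement is proved in the form the machine half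
(`ThreeColouringMachine.lean`) emits. To avoid renaming the variables of a code, the role of a
variable node is played by a LITERAL SLOT `p = (clause i, position j)`, `j < 3`, of the input padded
to three slots per clause (`OneInThree.pad3`); slots carrying the same variable are tied by the
arcs `{x_p, x̄_q}` (for `p = q` the arc `{x, x̄}`, for `p ≠ q` it forces equal truth values). The
palette is likewise indexed by slots: the nodes `(pal, (i, j))` form a complete tripartite graph on
the classes `j = 0` (`T`), `j = 1` (`F`), `j = 2` (`B`), so that within a class all nodes have the
same colour; the six gadget nodes of clause `i` are `(lo, (i, 0/1/2)) = p₁/q₁/o₁` and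
`(hi, (i, 0/1/2)) = p₂/q₂/o₂`. So the vertex set is `Kind × (Fin r × Fin 3)` (`15 r` nodes for
`r` clauses) and the palette has `3` colours.

* `ThreeColouring.Adj L` / `ThreeColouring.graph L` — the graph determined by the slot literals
  `L : Fin r × Fin 3 → Literal ℕ`;
* `ThreeColouring.colorable_of_slots` (completeness), `ThreeColouring.exists_true_slot`
  (soundness: in a proper 3-colouring some literal node of every clause has the colour of `T`);
* **`ThreeColouring.colorable_iff_satisfiable`**: for a CNF of width `≤ 3` without empty clauses,
  `(graph (slotLit φ)).Colorable 3 ↔ φ.Satisfiable`.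

Deliberately not here: planarity / degree-4 refinements of Garey–Johnson–Stockmeyer (only the
plain 3-colourability gadget is formalised); the machine half and the language `THREECOL`.

## References

* [CLRS2009] T. H. Cormen, C. E. Leiserson, R. L. Rivest, C. Stein, *Introduction to Algorithms*,
  3rd ed., MIT Press 2009, Problem 34-3 "Graph coloring" (3-COLOR is NP-complete, reduction from
  3-CNF-SAT with a palette, literal edges and a clause widget).
* [Stockmeyer1973] L. J. Stockmeyer, *Planar 3-colorability is polynomial complete*, ACM SIGACT
  News 5:3 (1973) 19–25 (the original NP-completeness of 3-colourability).
* [GareyJohnsonStockmeyer1976] M. R. Garey, D. S. Johnson, L. J. Stockmeyer, *Some simplified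
  NP-complete graph problems*, Theoret. Comput. Sci. 1 (1976) 237–267 (degree- and
  planarity-restricted versions).
* [GareyJohnson1979] M. R. Garey, D. S. Johnson, *Computers and Intractability* (1979), A1.1 [GT4]
  GRAPH K-COLORABILITY (NP-complete for every fixed `K ≥ 3`).
-/

namespace Literature.Computability.Complexity

namespace ThreeColouring

open KarpChromatic (Slot slotLit slotLit_spec)

/-! ### Node kinds and the graph of a family of slot literals -/

/-- The five kinds of nodes: a palette node, the positive / negative literal node of a slot, and a
node of the first (`lo`) or second (`hi`) OR-gadget of a clause. [folklore] -/
inductive Kind : Type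
  | pal : Kind
  | pos : Kind
  | neg : Kind
  | lo : Kind
  | hi : Kind
  deriving DecidableEq, Repr

/-- The numbering of the kinds used by the code of the graph:
`0 ↦ pal, 1 ↦ pos, 2 ↦ neg, 3 ↦ lo, 4 ↦ hi`. [folklore] -/
def kindOfFin : Fin 5 → Kind
  | ⟨0, _⟩ => Kind.pal
  | ⟨1, _⟩ => Kind.pos
  | ⟨2, _⟩ => Kind.neg
  | ⟨3, _⟩ => Kind.lo
  | ⟨_ + 4, _⟩ => Kind.hi

/-- The inverse numbering. [folklore] -/
def finOfKind : Kind → Fin 5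
  | Kind.pal => 0
  | Kind.pos => 1
  | Kind.neg => 2
  | Kind.lo => 3
  | Kind.hi => 4

/-- `Fin 5 ≃ Kind`. [folklore] -/
def kindEquiv : Fin 5 ≃ Kind where
  toFun := kindOfFin
  invFun := finOfKind
  left_inv i := by
    match i with
    | ⟨0, _⟩ => rfl
    | ⟨1, _⟩ => rfl
    | ⟨2, _⟩ => rfl
    | ⟨3, _⟩ => rfl
    | ⟨4, _⟩ => rfl
    | ⟨n + 5, h⟩ => exact absurd h (by omega)
  right_inv k := by cases k <;> rfl

/-- `Kind` is finite (five elements). [folklore] -/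
instance : Fintype Kind := Fintype.ofEquiv (Fin 5) kindEquiv

/-- Values of `kindEquiv`. [folklore] -/
@[simp] theorem kindEquiv_zero : kindEquiv 0 = Kind.pal := rfl
/-- Values of `kindEquiv`. [folklore] -/
@[simp] theorem kindEquiv_one : kindEquiv 1 = Kind.pos := rfl
/-- Values of `kindEquiv`. [folklore] -/
@[simp] theorem kindEquiv_two : kindEquiv 2 = Kind.neg := rfl
/-- Values of `kindEquiv`. [folklore] -/
@[simp] theorem kindEquiv_three : kindEquiv 3 = Kind.lo := rfl
/-- Values of `kindEquiv`. [folklore] -/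
@[simp] theorem kindEquiv_four : kindEquiv 4 = Kind.hi := rfl

/-- The nodes of the gadget graph for `r` clauses: a kind and a slot. [folklore] -/
abbrev Vtx (r : ℕ) : Type := Kind × Slot r

variable {r : ℕ}

/-- **The arcs of the gadget graph** on slots (`L p` the literal of slot `p`; the literal node of
slot `p` is `(pos, p)` if `L p` is positive and `(neg, p)` otherwise):
palette `{(pal, p), (pal, q)}` for `p.2 ≠ q.2` (complete tripartite on the classes `T = 0`,
`F = 1`, `B = 2`); `{x_p, B}`, `{x̄_p, B}` (every literal node to every class-`2` palette node);
`{x_p, x̄_q}` whenever `p, q` carry the same variable; the two triangles `p₁ q₁ o₁ = (lo, (i, 0/1/2))`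
and `p₂ q₂ o₂ = (hi, (i, 0/1/2))` of clause `i`; `p₁ ∼ ℓ_{(i,0)}`, `q₁ ∼ ℓ_{(i,1)}`, `p₂ ∼ o₁`,
`q₂ ∼ ℓ_{(i,2)}`; and `o₂ ∼ F`, `o₂ ∼ B` (every palette node of class `≠ 0`).
[cite: CLRS2009, Problem 34-3 (3-COLOR via 3-CNF-SAT)] -/
def Adj (L : Slot r → Literal ℕ) : Vtx r → Vtx r → Prop
  | (Kind.pal, p), (Kind.pal, q) => p.2 ≠ q.2
  | (Kind.pos, _), (Kind.pal, q) => q.2 = 2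
  | (Kind.pal, q), (Kind.pos, _) => q.2 = 2
  | (Kind.neg, _), (Kind.pal, q) => q.2 = 2
  | (Kind.pal, q), (Kind.neg, _) => q.2 = 2
  | (Kind.pos, p), (Kind.neg, q) => (L p).1 = (L q).1
  | (Kind.neg, p), (Kind.pos, q) => (L p).1 = (L q).1
  | (Kind.lo, p), (Kind.lo, q) => p.1 = q.1 ∧ p.2 ≠ q.2
  | (Kind.hi, p), (Kind.hi, q) => p.1 = q.1 ∧ p.2 ≠ q.2
  | (Kind.lo, p), (Kind.pos, q) => p.1 = q.1 ∧ p.2 = q.2 ∧ p.2 ≠ 2 ∧ (L q).2 = true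
  | (Kind.pos, q), (Kind.lo, p) => p.1 = q.1 ∧ p.2 = q.2 ∧ p.2 ≠ 2 ∧ (L q).2 = true
  | (Kind.lo, p), (Kind.neg, q) => p.1 = q.1 ∧ p.2 = q.2 ∧ p.2 ≠ 2 ∧ (L q).2 = false
  | (Kind.neg, q), (Kind.lo, p) => p.1 = q.1 ∧ p.2 = q.2 ∧ p.2 ≠ 2 ∧ (L q).2 = false
  | (Kind.hi, p), (Kind.lo, q) => p.1 = q.1 ∧ p.2 = 0 ∧ q.2 = 2
  | (Kind.lo, q), (Kind.hi, p) => p.1 = q.1 ∧ p.2 = 0 ∧ q.2 = 2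
  | (Kind.hi, p), (Kind.pos, q) => p.1 = q.1 ∧ p.2 = 1 ∧ q.2 = 2 ∧ (L q).2 = true
  | (Kind.pos, q), (Kind.hi, p) => p.1 = q.1 ∧ p.2 = 1 ∧ q.2 = 2 ∧ (L q).2 = true
  | (Kind.hi, p), (Kind.neg, q) => p.1 = q.1 ∧ p.2 = 1 ∧ q.2 = 2 ∧ (L q).2 = false
  | (Kind.neg, q), (Kind.hi, p) => p.1 = q.1 ∧ p.2 = 1 ∧ q.2 = 2 ∧ (L q).2 = false
  | (Kind.hi, p), (Kind.pal, q) => p.2 = 2 ∧ q.2 ≠ 0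
  | (Kind.pal, q), (Kind.hi, p) => p.2 = 2 ∧ q.2 ≠ 0
  | _, _ => False

/-- The arc relation is symmetric. [folklore] -/
theorem adj_symm (L : Slot r → Literal ℕ) {a b : Vtx r} (h : Adj L a b) : Adj L b a := by
  obtain ⟨ka, p⟩ := a
  obtain ⟨kb, q⟩ := b
  cases ka <;> cases kb <;> simp only [Adj] at h ⊢
  all_goals first
    | exact h
    | exact h.symm
    | exact fun e => h e.symm
    | exact ⟨h.1.symm, fun e => h.2 e.symm⟩

/-- The arc relation is irreflexive. [folklore] -/
theorem adj_irrefl (L : Slot r → Literal ℕ) (a : Vtx r) : ¬ Adj L a a := by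
  obtain ⟨ka, p⟩ := a
  cases ka <;> simp [Adj]

/-- **The gadget graph** of a family of slot literals. [cite: CLRS2009, Problem 34-3 (3-COLOR via 3-CNF-SAT)] -/
def graph (L : Slot r → Literal ℕ) : SimpleGraph (Vtx r) where
  Adj := Adj L
  symm := ⟨fun _ _ h => adj_symm L h⟩
  loopless := ⟨fun a h => adj_irrefl L a h⟩

/-- Unfolding the adjacency of `graph L`. [folklore] -/
theorem graph_adj (L : Slot r → Literal ℕ) (a b : Vtx r) : (graph L).Adj a b ↔ Adj L a b :=
  Iff.rfl

/-- Adjacency in the gadget graph is decidable. [folklore] -/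
instance (L : Slot r → Literal ℕ) : DecidableRel (graph L).Adj := fun a b => by
  obtain ⟨ka, p⟩ := a
  obtain ⟨kb, q⟩ := b
  rw [graph_adj]
  cases ka <;> cases kb <;> simp only [Adj] <;> infer_instance

/-- The literal node of slot `p`: `x_p = (pos, p)` for a positive literal, `x̄_p = (neg, p)` for a
negative one. [folklore] -/
def litVtx (L : Slot r → Literal ℕ) (p : Slot r) : Vtx r :=
  if (L p).2 then (Kind.pos, p) else (Kind.neg, p)

/-! ### Arithmetic of three colours -/

/-- The third colour: for `a ≠ b` the one element of `Fin 3` different from both. [folklore] -/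
def thirdOf (a b : Fin 3) : Fin 3 := ⟨(6 - (a : ℕ) - (b : ℕ)) % 3, Nat.mod_lt _ (by omega)⟩

/-- For `a ≠ b`, `thirdOf a b` differs from both and every colour different from both is it.
[folklore] -/
theorem thirdOf_spec : ∀ a b : Fin 3, a ≠ b →
    thirdOf a b ≠ a ∧ thirdOf a b ≠ b ∧ ∀ x : Fin 3, x ≠ a → x ≠ b → x = thirdOf a b := by
  decide

/-- Uniqueness of the third colour: two colours avoiding the same two distinct colours are equal.
[folklore] -/
theorem eq_of_ne_of_ne {a b x y : Fin 3} (hab : a ≠ b) (hxa : x ≠ a) (hxb : x ≠ b) (hya : y ≠ a)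
    (hyb : y ≠ b) : x = y := by
  obtain ⟨-, -, h⟩ := thirdOf_spec a b hab
  rw [h x hxa hxb, h y hya hyb]

/-! ### From a satisfying assignment to a colouring -/

section Complete

variable (L : Slot r → Literal ℕ) (σ : ℕ → Bool)

/-- The colour of a literal node of truth value `b`: `T = 0` if true, `F = 1` if false. [folklore] -/
def litColour (b : Bool) : Fin 3 := if b then 0 else 1

/-- The colours of the first OR-gadget `p₁ q₁ o₁` on inputs of truth values `a, b` (output `o₁`
coloured `T` iff `a ∨ b`). [cite: CLRS2009, Problem 34-3 (3-COLOR via 3-CNF-SAT)] -/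
def loColour (a b : Bool) : Fin 3 → Fin 3
  | ⟨0, _⟩ => if a then 1 else if b then 2 else 0
  | ⟨1, _⟩ => if a then 2 else if b then 1 else 2
  | ⟨_ + 2, _⟩ => if a || b then 0 else 1

/-- The colours of the second OR-gadget `p₂ q₂ o₂` on first input of truth value `ab` (output `o₂`
coloured `T`). [cite: CLRS2009, Problem 34-3 (3-COLOR via 3-CNF-SAT)] -/
def hiColour (ab : Bool) : Fin 3 → Fin 3
  | ⟨0, _⟩ => if ab then 1 else 2
  | ⟨1, _⟩ => if ab then 2 else 1
  | ⟨_ + 2, _⟩ => 0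

/-- The truth value of the literal of slot `p`. [folklore] -/
def val (p : Slot r) : Bool := (L p).eval σ

/-- **The colouring from an assignment**: palette node of class `j ↦ j`; `x_p ↦ T/F` by the value
of its variable and `x̄_p` the other way; the gadget nodes of clause `i` by `loColour`, `hiColour`
on the truth values of its three slot literals. [cite: CLRS2009, Problem 34-3 (3-COLOR via 3-CNF-SAT)] -/
def colourOf : Vtx r → Fin 3
  | (Kind.pal, p) => p.2
  | (Kind.pos, p) => if σ (L p).1 then 0 else 1
  | (Kind.neg, p) => if σ (L p).1 then 1 else 0
  | (Kind.lo, p) => loColour (val L σ (p.1, 0)) (val L σ (p.1, 1)) p.2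
  | (Kind.hi, p) => hiColour (val L σ (p.1, 0) || val L σ (p.1, 1)) p.2

/-- The colour of a positive literal node is `litColour` of its truth value. [folklore] -/
theorem colourOf_pos {p : Slot r} (hp : (L p).2 = true) :
    colourOf L σ (Kind.pos, p) = litColour (val L σ p) := by
  simp only [colourOf, val, Literal.eval, hp, litColour]
  cases σ (L p).1 <;> rfl

/-- The colour of a negative literal node is `litColour` of its truth value. [folklore] -/
theorem colourOf_neg {p : Slot r} (hp : (L p).2 = false) :
    colourOf L σ (Kind.neg, p) = litColour (val L σ p) := by
  simp only [colourOf, val, Literal.eval, hp, litColour]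
  cases σ (L p).1 <;> rfl

/-- Gadget facts, all by exhaustion over the truth values: the first triangle is properly
coloured. [folklore] -/
theorem lo_ne_lo : ∀ (a b : Bool) (j j' : Fin 3), j ≠ j' → loColour a b j ≠ loColour a b j' := by
  decide

/-- The second triangle is properly coloured. [folklore] -/
theorem hi_ne_hi : ∀ (ab : Bool) (j j' : Fin 3), j ≠ j' → hiColour ab j ≠ hiColour ab j' := by
  decide

/-- `p₁ ≠ ℓ₀`. [folklore] -/
theorem lo_zero_ne : ∀ a b : Bool, loColour a b 0 ≠ litColour a := by decide

/-- `q₁ ≠ ℓ₁`. [folklore] -/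
theorem lo_one_ne : ∀ a b : Bool, loColour a b 1 ≠ litColour b := by decide

/-- `p₂ ≠ o₁`. [folklore] -/
theorem hi_zero_ne : ∀ a b : Bool, hiColour (a || b) 0 ≠ loColour a b 2 := by decide

/-- `q₂ ≠ ℓ₂` provided the clause is true. [folklore] -/
theorem hi_one_ne : ∀ a b c : Bool, (a || b || c) = true → hiColour (a || b) 1 ≠ litColour c := by
  decide

/-- `o₂ = T` differs from the palette classes `F, B`. [folklore] -/
theorem hi_two_ne : ∀ (ab : Bool) (j : Fin 3), j ≠ 0 → hiColour ab 2 ≠ j := by decide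

/-- Literal colours are not `B`. [folklore] -/
theorem litColour_ne_two (b : Bool) : litColour b ≠ 2 := by cases b <;> decide

variable (w : Fin r → Fin 3)

/-- **The colouring is proper** when every chosen slot `(f, w f)` carries a literal true under `σ`.
[cite: CLRS2009, Problem 34-3 (3-COLOR via 3-CNF-SAT)] -/
theorem colourOf_valid (hw : ∀ f : Fin r, (L (f, w f)).eval σ = true) {a b : Vtx r}
    (h : (graph L).Adj a b) : colourOf L σ a ≠ colourOf L σ b := by
  -- the clause of every slot is true: `ℓ₀ ∨ ℓ₁ ∨ ℓ₂`
  have hcl : ∀ i : Fin r, (val L σ (i, 0) || val L σ (i, 1) || val L σ (i, 2)) = true := by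
    intro i
    have h := hw i
    simp only [val, Bool.or_eq_true]
    match hi : w i with
    | ⟨0, _⟩ => rw [hi] at h; exact Or.inl (Or.inl h)
    | ⟨1, _⟩ => rw [hi] at h; exact Or.inl (Or.inr h)
    | ⟨2, _⟩ => rw [hi] at h; exact Or.inr h
  rw [graph_adj] at h
  obtain ⟨ka, p⟩ := a
  obtain ⟨kb, q⟩ := b
  cases ka <;> cases kb <;> simp only [Adj] at h
  · -- pal / pal
    exact h
  · -- pal / pos
    simp only [colourOf, h]
    split_ifs <;> decide
  · -- pal / neg
    simp only [colourOf, h]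
    split_ifs <;> decide
  · -- pal / hi
    obtain ⟨hq2, hp⟩ := h
    have hq : q = (q.1, 2) := Prod.ext rfl hq2
    rw [hq]
    simp only [colourOf]
    exact (hi_two_ne _ p.2 hp).symm
  · -- pos / pal
    simp only [colourOf, h]
    split_ifs <;> decide
  · -- pos / neg, same variable
    simp only [colourOf, h]
    split_ifs <;> decide
  · -- pos / lo : `q = p` is the slot, positive literal, position `≠ 2`
    obtain ⟨h1, h2, h3, hpol⟩ := h
    have hqp : q = p := Prod.ext h1 h2
    subst hqp
    rw [colourOf_pos L σ hpol]
    simp only [colourOf]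
    match hj : q.2 with
    | ⟨0, _⟩ =>
      have hq : q = (q.1, 0) := Prod.ext rfl hj
      exact fun e => lo_zero_ne _ _ (by rw [← hq] at e; exact e.symm)
    | ⟨1, _⟩ =>
      have hq : q = (q.1, 1) := Prod.ext rfl hj
      exact fun e => lo_one_ne _ _ (by rw [← hq] at e; exact e.symm)
    | ⟨2, _⟩ => exact absurd hj h3
  · -- pos / hi : `p` is slot `(i, 2)`, positive, `q = (i, 1)`
    obtain ⟨h1, h2, h3, hpol⟩ := h
    rw [colourOf_pos L σ hpol]
    simp only [colourOf, h2]
    have hp : p = (q.1, 2) := Prod.ext h1.symm h3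
    rw [hp]
    exact fun e => hi_one_ne _ _ _ (hcl q.1) e.symm
  · -- neg / pal
    simp only [colourOf, h]
    split_ifs <;> decide
  · -- neg / pos, same variable
    simp only [colourOf, h]
    split_ifs <;> decide
  · -- neg / lo
    obtain ⟨h1, h2, h3, hpol⟩ := h
    have hqp : q = p := Prod.ext h1 h2
    subst hqp
    rw [colourOf_neg L σ hpol]
    simp only [colourOf]
    match hj : q.2 with
    | ⟨0, _⟩ =>
      have hq : q = (q.1, 0) := Prod.ext rfl hj
      exact fun e => lo_zero_ne _ _ (by rw [← hq] at e; exact e.symm)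
    | ⟨1, _⟩ =>
      have hq : q = (q.1, 1) := Prod.ext rfl hj
      exact fun e => lo_one_ne _ _ (by rw [← hq] at e; exact e.symm)
    | ⟨2, _⟩ => exact absurd hj h3
  · -- neg / hi
    obtain ⟨h1, h2, h3, hpol⟩ := h
    rw [colourOf_neg L σ hpol]
    simp only [colourOf, h2]
    have hp : p = (q.1, 2) := Prod.ext h1.symm h3
    rw [hp]
    exact fun e => hi_one_ne _ _ _ (hcl q.1) e.symm
  · -- lo / pos
    obtain ⟨h1, h2, h3, hpol⟩ := h
    have hqp : q = p := (Prod.ext h1 h2).symm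
    subst hqp
    rw [colourOf_pos L σ hpol]
    simp only [colourOf]
    match hj : q.2 with
    | ⟨0, _⟩ =>
      have hq : q = (q.1, 0) := Prod.ext rfl hj
      exact fun e => lo_zero_ne _ _ (by rw [← hq] at e; exact e)
    | ⟨1, _⟩ =>
      have hq : q = (q.1, 1) := Prod.ext rfl hj
      exact fun e => lo_one_ne _ _ (by rw [← hq] at e; exact e)
    | ⟨2, _⟩ => exact absurd hj h3
  · -- lo / neg
    obtain ⟨h1, h2, h3, hpol⟩ := h
    have hqp : q = p := (Prod.ext h1 h2).symm
    subst hqp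
    rw [colourOf_neg L σ hpol]
    simp only [colourOf]
    match hj : q.2 with
    | ⟨0, _⟩ =>
      have hq : q = (q.1, 0) := Prod.ext rfl hj
      exact fun e => lo_zero_ne _ _ (by rw [← hq] at e; exact e)
    | ⟨1, _⟩ =>
      have hq : q = (q.1, 1) := Prod.ext rfl hj
      exact fun e => lo_one_ne _ _ (by rw [← hq] at e; exact e)
    | ⟨2, _⟩ => exact absurd hj h3
  · -- lo / lo
    obtain ⟨h1, h2⟩ := h
    simp only [colourOf, h1]
    exact lo_ne_lo _ _ _ _ h2
  · -- lo / hi : `p = (i, 2) = o₁`, `q = (i, 0) = p₂`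
    obtain ⟨h1, h2, h3⟩ := h
    simp only [colourOf, h1, h2, h3]
    exact fun e => hi_zero_ne _ _ e.symm
  · -- hi / pal
    obtain ⟨hp2, hq⟩ := h
    simp only [colourOf, hp2]
    exact hi_two_ne _ q.2 hq
  · -- hi / pos
    obtain ⟨h1, h2, h3, hpol⟩ := h
    rw [colourOf_pos L σ hpol]
    simp only [colourOf, h2]
    have hq : q = (p.1, 2) := Prod.ext h1.symm h3
    rw [hq]
    exact hi_one_ne _ _ _ (hcl p.1)
  · -- hi / neg
    obtain ⟨h1, h2, h3, hpol⟩ := h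
    rw [colourOf_neg L σ hpol]
    simp only [colourOf, h2]
    have hq : q = (p.1, 2) := Prod.ext h1.symm h3
    rw [hq]
    exact hi_one_ne _ _ _ (hcl p.1)
  · -- hi / lo
    obtain ⟨h1, h2, h3⟩ := h
    simp only [colourOf, h1, h2, h3]
    exact hi_zero_ne _ _
  · -- hi / hi
    obtain ⟨h1, h2⟩ := h
    simp only [colourOf, h1]
    exact hi_ne_hi _ _ _ h2

/-- **Completeness**: if some assignment makes a literal of a slot of every clause true, the gadget
graph is `3`-colourable. [cite: CLRS2009, Problem 34-3 (3-COLOR via 3-CNF-SAT)] -/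
theorem colorable_of_slots (hw : ∀ f : Fin r, (L (f, w f)).eval σ = true) : (graph L).Colorable 3 :=
  ⟨SimpleGraph.Coloring.mk (colourOf L σ) fun h => colourOf_valid L σ w hw h⟩

end Complete

/-! ### From a colouring to a satisfying assignment -/

section Sound

variable {L : Slot r → Literal ℕ} (C : (graph L).Coloring (Fin 3))

/-- The two other positions of a position `j < 3`. [folklore] -/
theorem succ_ne : ∀ j : Fin 3, j + 1 ≠ j ∧ j + 2 ≠ j ∧ j + 1 ≠ j + 2 := by decide

/-- Two colours avoiding one colour `b` and a common colour `z ≠ b` are equal. [folklore] -/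
theorem eq_of_ne_common {b x y z : Fin 3} (hx : x ≠ b) (hy : y ≠ b) (hz : z ≠ b) (hxz : x ≠ z)
    (hyz : y ≠ z) : x = y := by
  apply Fin.ext
  simp only [ne_eq, Fin.ext_iff] at hx hy hz hxz hyz
  omega

/-- Two distinct colours avoiding `B`: one is not `T` iff the other is `T`. [folklore] -/
theorem ne_iff_eq_of_ne : ∀ T B x y : Fin 3, T ≠ B → x ≠ B → y ≠ B → x ≠ y → (x ≠ T ↔ y = T) := by
  decide

/-- **Palette classes are monochromatic**: two palette nodes of the same class have the same
colour (both avoid the colours of the nodes `(pal, (p.1, j + 1))`, `(pal, (p.1, j + 2))` of the two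
other classes, which are adjacent to each other). [folklore] -/
theorem pal_eq_pal (p q : Slot r) (h : p.2 = q.2) : C (Kind.pal, p) = C (Kind.pal, q) := by
  obtain ⟨h1, h2, h12⟩ := succ_ne p.2
  have hab : C (Kind.pal, (p.1, p.2 + 1)) ≠ C (Kind.pal, (p.1, p.2 + 2)) :=
    C.valid (show (graph L).Adj (Kind.pal, (p.1, p.2 + 1)) (Kind.pal, (p.1, p.2 + 2)) from h12)
  have hpa : C (Kind.pal, p) ≠ C (Kind.pal, (p.1, p.2 + 1)) :=
    C.valid (show (graph L).Adj (Kind.pal, p) (Kind.pal, (p.1, p.2 + 1)) from fun e => h1 e.symm)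
  have hpb : C (Kind.pal, p) ≠ C (Kind.pal, (p.1, p.2 + 2)) :=
    C.valid (show (graph L).Adj (Kind.pal, p) (Kind.pal, (p.1, p.2 + 2)) from fun e => h2 e.symm)
  have hqa : C (Kind.pal, q) ≠ C (Kind.pal, (p.1, p.2 + 1)) :=
    C.valid (show (graph L).Adj (Kind.pal, q) (Kind.pal, (p.1, p.2 + 1)) from
      fun e => h1 (by rw [← h] at e; exact e.symm))
  have hqb : C (Kind.pal, q) ≠ C (Kind.pal, (p.1, p.2 + 2)) :=
    C.valid (show (graph L).Adj (Kind.pal, q) (Kind.pal, (p.1, p.2 + 2)) from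
      fun e => h2 (by rw [← h] at e; exact e.symm))
  exact eq_of_ne_of_ne hab hpa hpb hqa hqb

/-- Palette nodes of different classes have different colours. [folklore] -/
theorem pal_ne_pal (i : Fin r) {j j' : Fin 3} (h : j ≠ j') :
    C (Kind.pal, (i, j)) ≠ C (Kind.pal, (i, j')) :=
  C.valid (show (graph L).Adj (Kind.pal, (i, j)) (Kind.pal, (i, j')) from h)

/-- `x_p` avoids the colour `B`. [folklore] -/
theorem pos_ne_B (p : Slot r) (i : Fin r) : C (Kind.pos, p) ≠ C (Kind.pal, (i, 2)) :=
  C.valid (show (graph L).Adj (Kind.pos, p) (Kind.pal, (i, 2)) from rfl)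

/-- `x̄_p` avoids the colour `B`. [folklore] -/
theorem neg_ne_B (p : Slot r) (i : Fin r) : C (Kind.neg, p) ≠ C (Kind.pal, (i, 2)) :=
  C.valid (show (graph L).Adj (Kind.neg, p) (Kind.pal, (i, 2)) from rfl)

/-- The literal node of a slot avoids the colour `B`. [folklore] -/
theorem litVtx_ne_B (p : Slot r) (i : Fin r) : C (litVtx L p) ≠ C (Kind.pal, (i, 2)) := by
  unfold litVtx
  split_ifs
  · exact pos_ne_B C p i
  · exact neg_ne_B C p i

/-- `x_p ≠ x̄_q` in colour when `p, q` carry the same variable. [folklore] -/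
theorem pos_ne_neg {p q : Slot r} (h : (L p).1 = (L q).1) : C (Kind.pos, p) ≠ C (Kind.neg, q) :=
  C.valid (show (graph L).Adj (Kind.pos, p) (Kind.neg, q) from h)

/-- **Slots with the same variable agree**: `x_p` and `x_q` have the same colour (both, like `x̄_q`,
avoid `B`, and both differ from `x̄_q`). [cite: CLRS2009, Problem 34-3 (3-COLOR via 3-CNF-SAT)] -/
theorem pos_eq_pos_of_var {p q : Slot r} (h : (L p).1 = (L q).1) : C (Kind.pos, p) = C (Kind.pos, q) :=
  eq_of_ne_common (pos_ne_B C p p.1) (pos_ne_B C q p.1) (neg_ne_B C q p.1) (pos_ne_neg C h)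
    (pos_ne_neg C rfl)

/-- **The assignment read off a colouring**: a variable occurring in some slot `p` is true iff
`x_p` has the colour `T` of the class-`0` palette nodes (independent of `p` by `pos_eq_pos_of_var`,
`pal_eq_pal`); other variables are false. [cite: CLRS2009, Problem 34-3 (3-COLOR via 3-CNF-SAT)] -/
noncomputable def assignment (L : Slot r → Literal ℕ) (C : (graph L).Coloring (Fin 3)) : ℕ → Bool :=
  fun x =>
  open Classical in
  if h : ∃ p : Slot r, (L p).1 = x then
    decide (C (Kind.pos, Classical.choose h) = C (Kind.pal, ((Classical.choose h).1, 0)))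
  else false

/-- **The value of the variable of slot `p`**: `x_p` is coloured `T`. [folklore] -/
theorem assignment_var (p : Slot r) :
    assignment L C (L p).1 = decide (C (Kind.pos, p) = C (Kind.pal, (p.1, 0))) := by
  have h : ∃ q : Slot r, (L q).1 = (L p).1 := ⟨p, rfl⟩
  unfold assignment
  rw [dif_pos h, pos_eq_pos_of_var C (Classical.choose_spec h),
    pal_eq_pal C ((Classical.choose h).1, 0) (p.1, 0) rfl]

/-- **A slot literal is true under the assignment iff its literal node is coloured `T`.**
[cite: CLRS2009, Problem 34-3 (3-COLOR via 3-CNF-SAT)] -/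
theorem eval_eq_true_iff (p : Slot r) :
    (L p).eval (assignment L C) = true ↔ C (litVtx L p) = C (Kind.pal, (p.1, 0)) := by
  unfold Literal.eval litVtx
  rw [assignment_var C p]
  cases hpol : (L p).2
  · -- negative literal: true iff `x_p` is not `T` iff `x̄_p` is `T`
    simp only [Bool.false_eq_true, if_false]
    have key := ne_iff_eq_of_ne _ _ _ _ (pal_ne_pal C p.1 (by decide : (0 : Fin 3) ≠ 2))
      (pos_ne_B C p p.1) (neg_ne_B C p p.1) (pos_ne_neg C rfl)
    rw [← key]
    by_cases hc : C (Kind.pos, p) = C (Kind.pal, (p.1, 0)) <;> simp [hc]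
  · simp

/-- Adjacency of a first-gadget node `p₁ / q₁` and the literal node of its slot. [folklore] -/
theorem lo_adj_litVtx (i : Fin r) {j : Fin 3} (hj : j ≠ 2) : (graph L).Adj (Kind.lo, (i, j)) (litVtx L (i, j)) := by
  unfold litVtx
  by_cases hpol : (L (i, j)).2 = true
  · rw [if_pos hpol]
    exact ⟨rfl, rfl, hj, hpol⟩
  · rw [if_neg hpol]
    exact ⟨rfl, rfl, hj, Bool.eq_false_iff.2 hpol⟩

/-- Adjacency of `q₂` and the literal node of slot `(i, 2)`. [folklore] -/
theorem hi_adj_litVtx (i : Fin r) : (graph L).Adj (Kind.hi, (i, 1)) (litVtx L (i, 2)) := by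
  unfold litVtx
  by_cases hpol : (L (i, 2)).2 = true
  · rw [if_pos hpol]
    exact ⟨rfl, rfl, rfl, hpol⟩
  · rw [if_neg hpol]
    exact ⟨rfl, rfl, rfl, Bool.eq_false_iff.2 hpol⟩

/-- **Soundness of the clause gadget**: in a proper 3-colouring some literal node of every clause
has the colour `T` (if all three were `F`, the first OR-gadget would output `F`, the second is
forced to output `T`, and then `p₂, q₂` would both be `B`). [cite: CLRS2009, Problem 34-3 (3-COLOR via 3-CNF-SAT)] -/
theorem exists_true_slot (i : Fin r) : ∃ j : Fin 3, C (litVtx L (i, j)) = C (Kind.pal, (i, 0)) := by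
  by_contra hno
  push Not at hno
  have hTF := pal_ne_pal C i (by decide : (0 : Fin 3) ≠ 1)
  have hTB := pal_ne_pal C i (by decide : (0 : Fin 3) ≠ 2)
  have hFB := pal_ne_pal C i (by decide : (1 : Fin 3) ≠ 2)
  -- the literal nodes are `F`
  have hlit : ∀ j : Fin 3, C (litVtx L (i, j)) = C (Kind.pal, (i, 1)) := fun j =>
    eq_of_ne_of_ne hTB (hno j) (litVtx_ne_B C (i, j) i) hTF.symm hFB
  -- first gadget: `p₁, q₁ ≠ F`, triangle, so `o₁ = F`
  have hp₁ : C (Kind.lo, (i, 0)) ≠ C (Kind.pal, (i, 1)) := by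
    rw [← hlit 0]; exact C.valid (lo_adj_litVtx i (by decide))
  have hq₁ : C (Kind.lo, (i, 1)) ≠ C (Kind.pal, (i, 1)) := by
    rw [← hlit 1]; exact C.valid (lo_adj_litVtx i (by decide))
  have hlo : ∀ {j j' : Fin 3}, j ≠ j' → C (Kind.lo, (i, j)) ≠ C (Kind.lo, (i, j')) := fun h =>
    C.valid (show (graph L).Adj (Kind.lo, (i, _)) (Kind.lo, (i, _)) from ⟨rfl, h⟩)
  have ho₁ : C (Kind.lo, (i, 2)) = C (Kind.pal, (i, 1)) :=
    eq_of_ne_of_ne (hlo (by decide : (0 : Fin 3) ≠ 1)) (hlo (by decide)) (hlo (by decide)) hp₁.symm hq₁.symm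
  -- second gadget: `p₂ ≠ o₁ = F`, `q₂ ≠ ℓ₂ = F`, `o₂ ∉ {F, B}` so `o₂ = T`, and `p₂ = q₂ = B`
  have hp₂ : C (Kind.hi, (i, 0)) ≠ C (Kind.pal, (i, 1)) := by
    rw [← ho₁]; exact C.valid (show (graph L).Adj (Kind.hi, (i, 0)) (Kind.lo, (i, 2)) from ⟨rfl, rfl, rfl⟩)
  have hq₂ : C (Kind.hi, (i, 1)) ≠ C (Kind.pal, (i, 1)) := by
    rw [← hlit 2]; exact C.valid (hi_adj_litVtx i)
  have ho₂F : C (Kind.hi, (i, 2)) ≠ C (Kind.pal, (i, 1)) :=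
    C.valid (show (graph L).Adj (Kind.hi, (i, 2)) (Kind.pal, (i, 1)) from ⟨rfl, (by decide : (1 : Fin 3) ≠ 0)⟩)
  have ho₂B : C (Kind.hi, (i, 2)) ≠ C (Kind.pal, (i, 2)) :=
    C.valid (show (graph L).Adj (Kind.hi, (i, 2)) (Kind.pal, (i, 2)) from ⟨rfl, (by decide : (2 : Fin 3) ≠ 0)⟩)
  have ho₂ : C (Kind.hi, (i, 2)) = C (Kind.pal, (i, 0)) := eq_of_ne_of_ne hFB ho₂F ho₂B hTF hTB
  have hhi : ∀ {j j' : Fin 3}, j ≠ j' → C (Kind.hi, (i, j)) ≠ C (Kind.hi, (i, j')) := fun h =>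
    C.valid (show (graph L).Adj (Kind.hi, (i, _)) (Kind.hi, (i, _)) from ⟨rfl, h⟩)
  have hp₂T : C (Kind.hi, (i, 0)) ≠ C (Kind.pal, (i, 0)) := by rw [← ho₂]; exact hhi (by decide)
  have hq₂T : C (Kind.hi, (i, 1)) ≠ C (Kind.pal, (i, 0)) := by rw [← ho₂]; exact hhi (by decide)
  exact hhi (by decide : (0 : Fin 3) ≠ 1) (eq_of_ne_of_ne hTF.symm hp₂ hp₂T hq₂ hq₂T)

end Sound

/-! ### The main equivalence -/

/-- The literal node of a slot carries a literal of its clause; read back through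
`eval_eq_true_iff`. **The equivalence** (3SAT ∝ GRAPH 3-COLOURABILITY): for a CNF of width `≤ 3`
without empty clauses, the gadget graph of its slot literals is `3`-colourable iff the CNF is
satisfiable. [cite: CLRS2009, Problem 34-3 (3-COLOR via 3-CNF-SAT)] -/
theorem colorable_iff_satisfiable (φ : CNF ℕ) (hw : φ.IsWidthLE 3) (hne : ([] : Clause ℕ) ∉ φ) :
    (graph (slotLit φ)).Colorable 3 ↔ φ.Satisfiable := by
  have hne' : ∀ i : Fin φ.length, φ[i] ≠ [] := fun i h => hne (h ▸ List.getElem_mem i.2)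
  constructor
  · rintro ⟨C⟩
    refine ⟨assignment (slotLit φ) C, (CNF.eval_eq_true_iff φ _).2 fun c hc => ?_⟩
    obtain ⟨i, hi, rfl⟩ := List.getElem_of_mem hc
    obtain ⟨j, hj⟩ := exists_true_slot C ⟨i, hi⟩
    have hmem := (slotLit_spec φ ⟨i, hi⟩ (hne' ⟨i, hi⟩)).1 j
    have hev := (eval_eq_true_iff C (⟨i, hi⟩, j)).2 hj
    simp only [Clause.eval, List.any_eq_true]
    exact ⟨_, hmem, hev⟩
  · rintro ⟨σ, hσ⟩
    have hcl : ∀ i : Fin φ.length, ∃ j, (slotLit φ (i, j)).eval σ = true := fun i =>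
      (slotLit_spec φ i (hne' i)).2 σ (hw _ (List.getElem_mem i.2))
        ((CNF.eval_eq_true_iff φ σ).1 hσ _ (List.getElem_mem i.2))
    choose w hw' using hcl
    exact colorable_of_slots (slotLit φ) σ w hw'

end ThreeColouring

end Literature.Computability.Complexity
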